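import Mathlib.Geometry.Manifold.VectorField.Pullback
import Literature.Geometry.Manifold.InjOnLocalDiffeomorphInverse
import Literature.Geometry.Lorentzian.LorentzianMetric
import Literature.Geometry.Lorentzian.Basic
import HarnessLib

/-!
# Crux `GapExhaustion` (stmt-FinalStateConjecture-10808), line `photon-shell-pseudoconvexity`:
# stub (N-5a) `stub_contMDiffOn_pushforwardField` — smoothness of the pushed-forward field

Route `BartnikGapSettling`; helper (`--supports stmt-FinalStateConjecture-10808`) landing the
registered glue stub (N-5a) of the outward Killing-extension sweep (S5 of the node
`EternalSilentNearKerrIsKerr`): the sweep produces a `C^∞` COORDINATE field `k` on an open set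
`W ⊆ E4` of an eternal star chart `Φ : E4 → 𝓢.carrier` (which is `C^∞` on `W`, injective on `W`,
with injective differential at every point of `W`), while the node wants a MANIFOLD field of `𝓢`
on `Φ '' W`. The pushed-forward section is `p ↦ dΦ_{Φ⁻¹ p} (k (Φ⁻¹ p))` with
`Φ⁻¹ := invFunOn Φ W`; this file proves that it is a `C^∞` section of `T𝓢` on the open set
`Φ '' W` (the Killing equation is the separate stub N-5b).

Proof: the pushforward by `Φ` is the PULLBACK `VectorField.mpullback (𝓡 4) 𝓘(ℝ, E4) ι k` by the
local inverse `ι := invFunOn Φ W`, which is `C^∞` on `Φ '' W`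
(`Literature.Geometry.Manifold.contMDiffAt_invFunOn_of_bijective_mfderiv`, the inverse function
theorem; the differentials `dΦ_y`, `y ∈ W`, are bijective as injective endomorphisms of `E4`) with
`dι_{Φ x}` and `dΦ_x` mutually inverse (`mfderiv_invFunOn_comp_mfderiv`,
`mfderiv_comp_mfderiv_invFunOn`), so that `(dι_{Φ x}).inverse = dΦ_x`
(`ContinuousLinearMap.inverse_eq`). Mathlib's `ContMDiffWithinAt.mpullback_vectorField_preimage`
gives `C^∞`-regularity of the pulled-back section within `ι ⁻¹' W ⊇ Φ '' W` at every point of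
`Φ '' W` (the section `k` of the trivial bundle `TE4` is `C^∞` on `W` by
`contMDiffOn_vectorSpace_iff_contDiffOn`), and the two sections agree on `Φ '' W`
(`ContMDiffOn.congr`). Mathlib + the tree's `InjOnLocalDiffeomorphInverse` only.
-/

noncomputable section

-- D-0017: single-problem summit, `Summit.<S>.<S>.…` by design (lakefile `weak.linter.dupNamespace`).
set_option linter.dupNamespace false

namespace Summit.FinalStateConjecture.FinalStateConjecture.Theorems

open Set Function Bundle
open Literature.Geometry.Lorentzian Literature.Geometry.Manifold
open scoped Manifold ContDiff Topology

/-- An injective differential `dΦ_y : E4 → T_{Φ y} 𝓢` of a chart map into a `4`-manifold is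
bijective (rank–nullity for an injective linear endomorphism of `E4`). [folklore] -/
private theorem pushFwd_bijective_mfderiv (𝓢 : Spacetime.{0} 4) (Φ : E4 → 𝓢.carrier)
    (W : Set E4) (hinj' : ∀ y ∈ W, Function.Injective (mfderiv 𝓘(ℝ, E4) (𝓡 4) Φ y)) :
    ∀ y ∈ W, Function.Bijective (mfderiv 𝓘(ℝ, E4) (𝓡 4) Φ y) := by
  intro y hy
  haveI : FiniteDimensional ℝ (TangentSpace 𝓘(ℝ, E4) y) := inferInstanceAs (FiniteDimensional ℝ E4)
  haveI : FiniteDimensional ℝ (TangentSpace (𝓡 4) (Φ y)) :=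
    inferInstanceAs (FiniteDimensional ℝ E4)
  exact ⟨hinj' y hy, (LinearMap.injective_iff_surjective_of_finrank_eq_finrank
    (f := (mfderiv 𝓘(ℝ, E4) (𝓡 4) Φ y).toLinearMap) rfl).mp (hinj' y hy)⟩

/-- For `x ∈ W`, `ContinuousLinearMap.inverse` of the differential at `Φ x` of the inverse
`invFunOn Φ W` is the differential `dΦ_x` (the two differentials are mutually inverse,
`mfderiv_invFunOn_comp_mfderiv` / `mfderiv_comp_mfderiv_invFunOn`, and
`ContinuousLinearMap.inverse_eq`). [folklore] -/
private theorem pushFwd_inverse_mfderiv_invFunOn (𝓢 : Spacetime.{0} 4) (Φ : E4 → 𝓢.carrier)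
    (W : Set E4) (hW : IsOpen W) (hΦ : ContMDiffOn 𝓘(ℝ, E4) (𝓡 4) ∞ Φ W)
    (hinj' : ∀ y ∈ W, Function.Injective (mfderiv 𝓘(ℝ, E4) (𝓡 4) Φ y)) (hinj : InjOn Φ W)
    {x : E4} (hx : x ∈ W) :
    (mfderiv (𝓡 4) 𝓘(ℝ, E4) (invFunOn Φ W) (Φ x)).inverse = mfderiv 𝓘(ℝ, E4) (𝓡 4) Φ x := by
  have hbij := pushFwd_bijective_mfderiv 𝓢 Φ W hinj'
  refine ContinuousLinearMap.inverse_eq ?_ ?_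
  · ext v
    exact mfderiv_invFunOn_comp_mfderiv hW hΦ hinj hbij hx v
  · ext u
    exact mfderiv_comp_mfderiv_invFunOn hW hΦ hinj hbij hx u

/-- On `Φ '' W` the pullback `VectorField.mpullback (𝓡 4) 𝓘(ℝ, E4) (invFunOn Φ W) k` of the
coordinate field `k` (a `C^∞` section of the trivial bundle `TE4` on `W`,
`contMDiffOn_vectorSpace_iff_contDiffOn`) along the local inverse `invFunOn Φ W` (which is `C^∞`
at every point of `Φ '' W` with invertible differential, inverse function theorem) is a `C^∞`
section of `T𝓢`: Mathlib's `ContMDiffWithinAt.mpullback_vectorField_preimage`, restricted from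
`(invFunOn Φ W) ⁻¹' W` to `Φ '' W`. [folklore] -/
private theorem pushFwd_mpullback_contMDiffOn (𝓢 : Spacetime.{0} 4) (Φ : E4 → 𝓢.carrier)
    (W : Set E4) (k : E4 → E4) (hW : IsOpen W) (hΦ : ContMDiffOn 𝓘(ℝ, E4) (𝓡 4) ∞ Φ W)
    (hinj' : ∀ y ∈ W, Function.Injective (mfderiv 𝓘(ℝ, E4) (𝓡 4) Φ y)) (hinj : InjOn Φ W)
    (hk : ContDiffOn ℝ ∞ k W) :
    ContMDiffOn (𝓡 4) ((𝓡 4).prod 𝓘(ℝ, E4)) ∞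
      (fun p ↦ (TotalSpace.mk' E4 p
        (VectorField.mpullback (𝓡 4) 𝓘(ℝ, E4) (invFunOn Φ W)
          (fun y : E4 ↦ (k y : TangentSpace 𝓘(ℝ, E4) y)) p) :
        TangentBundle (𝓡 4) 𝓢.carrier)) (Φ '' W) := by
  have hbij := pushFwd_bijective_mfderiv 𝓢 Φ W hinj'
  have hkV : ContMDiffOn 𝓘(ℝ, E4) (𝓘(ℝ, E4).prod 𝓘(ℝ, E4)) ∞
      (fun y ↦ (TotalSpace.mk' E4 y (k y) : TangentBundle 𝓘(ℝ, E4) E4)) W :=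
    contMDiffOn_vectorSpace_iff_contDiffOn.2 hk
  rintro _ ⟨x, hx, rfl⟩
  have hιx : invFunOn Φ W (Φ x) = x := invFunOn_apply hinj hx
  have hι : ContMDiffAt (𝓡 4) 𝓘(ℝ, E4) ∞ (invFunOn Φ W) (Φ x) :=
    contMDiffAt_invFunOn_of_bijective_mfderiv hW hΦ hinj hbij hx
  have hinv : (mfderiv (𝓡 4) 𝓘(ℝ, E4) (invFunOn Φ W) (Φ x)).IsInvertible := by
    refine ContinuousLinearMap.IsInvertible.of_inverse (g := mfderiv 𝓘(ℝ, E4) (𝓡 4) Φ x) ?_ ?_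
    · ext v
      exact mfderiv_invFunOn_comp_mfderiv hW hΦ hinj hbij hx v
    · ext u
      exact mfderiv_comp_mfderiv_invFunOn hW hΦ hinj hbij hx u
  have h := ContMDiffWithinAt.mpullback_vectorField_preimage (I := 𝓡 4) (I' := 𝓘(ℝ, E4))
    (m := ∞) (n := ∞) (t := W) (V := fun y : E4 ↦ (k y : TangentSpace 𝓘(ℝ, E4) y))
    (f := invFunOn Φ W) (x₀ := Φ x) (by rw [hιx]; exact hkV x hx) hι hinv (by simp)
  exact h.mono fun p hp ↦ Literature.Geometry.Manifold.invFunOn_mem hp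

/-- **Stub (N-5a) of the line `photon-shell-pseudoconvexity` (crux `GapExhaustion`,
stmt-FinalStateConjecture-10808) — smoothness of the pushed-forward coordinate field.** For a
spacetime `𝓢`, a map `Φ : E4 → 𝓢.carrier` which is `C^∞` and injective on the open set `W` with
injective differential at every point of `W`, and a coordinate field `k : E4 → E4` which is `C^∞`
on `W`, the pushed-forward section `p ↦ dΦ_{Φ⁻¹ p} (k (Φ⁻¹ p))`, `Φ⁻¹ = invFunOn Φ W`, is a `C^∞`
section of the tangent bundle of `𝓢.carrier` on `Φ '' W` (it is the pullback of `k` along the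
smooth local inverse `Φ⁻¹`, an equidimensional injective immersion being a diffeomorphism onto
its open image). O'Neill 1983, Ch. 1, Lemma 1.31 ff. [cite: ONeill1983, Ch. 1, Lemma 1.31] -/
theorem stub_contMDiffOn_pushforwardField :
    ∀ (𝓢 : Spacetime.{0} 4) (Φ : E4 → 𝓢.carrier) (W : Set E4) (k : E4 → E4),
      IsOpen W → ContMDiffOn 𝓘(ℝ, E4) (𝓡 4) ∞ Φ W →
      (∀ y ∈ W, Function.Injective (mfderiv 𝓘(ℝ, E4) (𝓡 4) Φ y)) → InjOn Φ W →
      ContDiffOn ℝ ∞ k W →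
      ContMDiffOn (𝓡 4) ((𝓡 4).prod 𝓘(ℝ, E4)) ∞
        (fun p : 𝓢.carrier ↦ (Bundle.TotalSpace.mk' E4 p
          (mfderiv 𝓘(ℝ, E4) (𝓡 4) Φ (invFunOn Φ W p) (k (invFunOn Φ W p)) : TangentSpace (𝓡 4) p)
            : TangentBundle (𝓡 4) 𝓢.carrier)) (Φ '' W) := by
  intro 𝓢 Φ W k hW hΦ hinj' hinj hk
  refine (pushFwd_mpullback_contMDiffOn 𝓢 Φ W k hW hΦ hinj' hinj hk).congr ?_
  rintro _ ⟨x, hx, rfl⟩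
  congr 1
  rw [VectorField.mpullback_apply, pushFwd_inverse_mfderiv_invFunOn 𝓢 Φ W hW hΦ hinj' hinj hx,
    invFunOn_apply hinj hx]

end Summit.FinalStateConjecture.FinalStateConjecture.Theorems

end
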